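import Summits.CriticalPhenomena.PercolationContinuityZ3.Theorems.PercNearOneGluingNoHeavyLowerTailSahiThreeCopySubstitution
import Summits.CriticalPhenomena.PercolationContinuityZ3.Theorems.PercNearOneGluingNoHeavyLowerTailSahiThreeCopyMarginal

/-!
# `NoHeavyLowerTail` (crux stmt-CriticalPhenomena-4575), Sahi programme: **UNIVERSALLY GOOD PAIRS ARE CLOSED UNDER BLOCKWISE
# MONOTONE SUBSTITUTION** — if `c_b(f,g,H) ≥ 0` for every profile and EVERY nonnegative monotone `H`, then the same holds for
# `(subst σ f, subst σ g)` with the third function FREE on the big cube: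
# `c_{(B₀,b)}(subst σ f, subst σ g, H) = Σ_{k=0}^{3} c_{(k,b)}(f, g, h̃_k)` with explicit nonnegative MONOTONE `h̃_k`

Support file (Sahi cell, seat `prim-sahi-p1`, generation 55; `--supports stmt-CriticalPhenomena-4575`); companion of `…Substitution`
(all three slots substituted: `tc_subst`) and `…Marginal` / `…Pairs` (3C-SAHI is a statement about PAIRS `(f,g)` with a free third
slot).  Here the third slot is NOT a substitution instance: `H : {0,1}^{d+e} → ℝ` is arbitrary.

THE IDENTITY (`tc_subst_free`).  Group the block arrangements `(y¹,y²,y³)` of `B₀` by the σ-pattern `(σy¹,σy²,σy³)` and read `H` in the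
copy that carries it; the PATTERN MARGINALS `G e B₀ σ₁σ₂σ₃ (η₁,η₂,η₃) H = Σ_{σ_j y^j = η_j} H(y¹,·)` (three inner functions for the
induction; `G`) are symmetric under swapping copies 2,3 (`G_swap23`), so with
`h̃_k(η,x) := Σ_{σy¹ = η, (σy²,σy³) = a fixed pattern of weight k−η} H(y¹,x)` (`hk`) every one of the five terms of `c_{(B₀,b)}` of the
substituted pair regroups into the corresponding term of `Σ_k c_{(k,b)}(f,g,h̃_k)` (`N3_subst_mul`, `N3_cons`).
THE POINT (`hk_monotone`): `h̃_k` IS MONOTONE IN THE SUBSTITUTED COORDINATE — `h̃_k(1,x) ≥ h̃_k(0,x)` is, after a copy swap, the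
inequality `Σ_{arr} σ(y¹)(1−σ)(y²)(1−σ)(y³)[H(y¹) − H(y²)] ≥ 0` resp. `Σ σ(y¹)σ(y²)(1−σ)(y³)[H(y¹) − H(y³)] ≥ 0`, i.e. THREE-COPY HARRIS ON
THE BLOCK with a spectator (`N3_le_N3_mul` of `…SahiThreeCopy`): `N(Hσ;1;r) ≥ N(H;σ;r)`.  (The unused sections `h̃_0(1,·)`, `h̃_3(0,·)` are
set so that monotonicity is free.)
CONSEQUENCE (`tc_subst_free_nonneg`): the closure theorem of the title; with `…Pairs`/`…MarginalLeFour` (universal goodness of every pair on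
`≤ 4` coordinates, of nested / cylinder / block-independent pairs, stability under lifting and renaming) it yields 3C-SAHI — hence Kahn's
inequality under every product measure — for every triple `(Φ_A(σ₁,…,σ₄), Φ_B(σ₁,…,σ₄), H)`: `A, B` ANY two events in the monotone algebra
generated by four increasing BLOCK EVENTS `σ_i` on pairwise disjoint blocks (arbitrary sizes, arbitrary increasing `σ_i`), `H` ARBITRARY.
Nothing conjectural is used or asserted.  [this work]
-/

namespace Summit.CriticalPhenomena.PercolationContinuityZ3.Theorems.SahiThreeCopy

open Finset Function Literature.Combinatorics.Sahi2008
open scoped BigOperators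

noncomputable section

variable {d : ℕ}

/-! ### §1 Pattern marginals of a free function over the block -/

/-- `H(y, x)` for `H` on `{0,1}^{d+e}`, block point `y`, back point `x` (by peeling front coordinates). [this work] -/
def happ : (e : ℕ) → (Pt (d + e) → ℝ) → Pt e → Pt d → ℝ
  | 0, H, _, x => H x
  | e + 1, H, y, x => happ e (sec H (y 0)) (Fin.tail y) x

/-- `happ` is nonnegative for nonnegative `H`. [this work] -/
theorem happ_nonneg : ∀ (e : ℕ) {H : Pt (d + e) → ℝ}, (∀ w, 0 ≤ H w) → ∀ y x, 0 ≤ happ e H y x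
  | 0, _, hH, _, x => hH x
  | e + 1, _, hH, y, x => happ_nonneg e (sec_nonneg hH (y 0)) (Fin.tail y) x

/-- `happ` is monotone in the block point and in the back point. [this work] -/
theorem happ_le_happ : ∀ (e : ℕ) {H : Pt (d + e) → ℝ}, Monotone H → ∀ {y y' : Pt e}, y ≤ y' → ∀ {x x' : Pt d}, x ≤ x' →
    happ e H y x ≤ happ e H y' x'
  | 0, _, hH, _, _, _, _, _, hxx' => hH hxx'
  | e + 1, H, hH, y, y', hyy', x, x', hxx' => by
    simp only [happ]
    calc happ e (sec H (y 0)) (Fin.tail y) x ≤ happ e (sec H (y 0)) (Fin.tail y') x' :=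
          happ_le_happ e (sec_monotone hH _) (fun i => hyy' i.succ) hxx'
      _ ≤ happ e (sec H (y' 0)) (Fin.tail y') x' := by
          have hsec : ∀ z, sec H (y 0) z ≤ sec H (y' 0) z := fun z => hH (Fin.cons_le_cons.2 ⟨hyy' 0, le_rfl⟩)
          exact happ_mono_fun e hsec _ _
where
  /-- pointwise monotonicity of `happ` in the function (auxiliary). [this work] -/
  happ_mono_fun : ∀ (e : ℕ) {H H' : Pt (d + e) → ℝ}, (∀ w, H w ≤ H' w) → ∀ y x, happ e H y x ≤ happ e H' y x
  | 0, _, _, hHH', _, x => hHH' x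
  | e + 1, _, _, hHH', y, x => happ_mono_fun e (fun z => hHH' _) _ x

/-- The PATTERN MARGINAL with three inner functions: `G(η) H (x) = Σ_{block arrangements with σ_j(y^j) = η_j} H(y¹, x)`
(defined by peeling front coordinates). [this work] -/
def G : (e : ℕ) → (Fin e → ℕ) → (Pt e → Bool) → (Pt e → Bool) → (Pt e → Bool) → Bool → Bool → Bool →
    (Pt (d + e) → ℝ) → Pt d → ℝ
  | 0, _, σ₁, σ₂, σ₃, η₁, η₂, η₃, H =>
    if σ₁ (fun i => Fin.elim0 i) = η₁ ∧ σ₂ (fun i => Fin.elim0 i) = η₂ ∧ σ₃ (fun i => Fin.elim0 i) = η₃ then H else 0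
  | e + 1, B₀, σ₁, σ₂, σ₃, η₁, η₂, η₃, H =>
    ∑ ε₁ : Bool, ∑ ε₂ : Bool, ∑ ε₃ : Bool, if ε₁.toNat + ε₂.toNat + ε₃.toNat = B₀ 0 then
      G e (Fin.tail B₀) (fun y => σ₁ (Fin.cons ε₁ y)) (fun y => σ₂ (Fin.cons ε₂ y)) (fun y => σ₃ (Fin.cons ε₃ y)) η₁ η₂ η₃ (sec H ε₁)
    else 0

/-- **`G` as a three-copy count on the block**: `G(η) H (x) = N_{B₀}([σ₁=η₁]·H(·,x); [σ₂=η₂]; [σ₃=η₃])`. [this work] -/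
theorem G_eq_N3 : ∀ (e : ℕ) (B₀ : Fin e → ℕ) (σ₁ σ₂ σ₃ : Pt e → Bool) (η₁ η₂ η₃ : Bool) (H : Pt (d + e) → ℝ) (x : Pt d),
    G e B₀ σ₁ σ₂ σ₃ η₁ η₂ η₃ H x =
      N3 B₀ (fun y => (if σ₁ y = η₁ then (1 : ℝ) else 0) * happ e H y x) (fun y => if σ₂ y = η₂ then 1 else 0)
        (fun y => if σ₃ y = η₃ then 1 else 0)
  | 0, B₀, σ₁, σ₂, σ₃, η₁, η₂, η₃, H, x => by
    rw [N3_dim_zero]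
    simp only [G, happ]
    by_cases h1 : σ₁ (fun i => Fin.elim0 i) = η₁ <;> by_cases h2 : σ₂ (fun i => Fin.elim0 i) = η₂ <;>
      by_cases h3 : σ₃ (fun i => Fin.elim0 i) = η₃ <;> simp [h1, h2, h3]
  | e + 1, B₀, σ₁, σ₂, σ₃, η₁, η₂, η₃, H, x => by
    have hB : B₀ = Fin.cons (B₀ 0) (Fin.tail B₀) := (Fin.cons_self_tail B₀).symm
    conv_rhs => rw [hB, N3_cons]
    simp only [G, Finset.sum_apply]
    refine sum_congr rfl fun ε₁ _ => sum_congr rfl fun ε₂ _ => sum_congr rfl fun ε₃ _ => ?_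
    have e1 : sec (fun y => (if σ₁ y = η₁ then (1 : ℝ) else 0) * happ (e + 1) H y x) ε₁ =
        fun y => (if σ₁ (Fin.cons ε₁ y) = η₁ then (1 : ℝ) else 0) * happ e (sec H ε₁) y x := by
      funext y; simp only [sec, happ, Fin.cons_zero, Fin.tail_cons]
    have e2 : sec (fun y => if σ₂ y = η₂ then (1 : ℝ) else 0) ε₂ = fun y => if σ₂ (Fin.cons ε₂ y) = η₂ then (1 : ℝ) else 0 := by
      funext y; simp only [sec]
    have e3 : sec (fun y => if σ₃ y = η₃ then (1 : ℝ) else 0) ε₃ = fun y => if σ₃ (Fin.cons ε₃ y) = η₃ then (1 : ℝ) else 0 := by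
      funext y; simp only [sec]
    rw [e1, e2, e3]
    split_ifs
    · exact G_eq_N3 e _ _ _ _ _ _ _ _ x
    · rfl

/-- `G ≥ 0` for `H ≥ 0`. [this work] -/
theorem G_nonneg (e : ℕ) (B₀ : Fin e → ℕ) (σ₁ σ₂ σ₃ : Pt e → Bool) (η₁ η₂ η₃ : Bool) {H : Pt (d + e) → ℝ} (hH : ∀ w, 0 ≤ H w)
    (x : Pt d) : 0 ≤ G e B₀ σ₁ σ₂ σ₃ η₁ η₂ η₃ H x := by
  rw [G_eq_N3]
  refine N3_nonneg B₀ (fun y => mul_nonneg ?_ (happ_nonneg e hH y x)) (fun y => ?_) (fun y => ?_) <;>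
    split_ifs <;> norm_num

/-- `G` is monotone in the back point for monotone `H`. [this work] -/
theorem G_mono_x (e : ℕ) (B₀ : Fin e → ℕ) (σ₁ σ₂ σ₃ : Pt e → Bool) (η₁ η₂ η₃ : Bool) {H : Pt (d + e) → ℝ} (hH : Monotone H)
    {x x' : Pt d} (hxx' : x ≤ x') : G e B₀ σ₁ σ₂ σ₃ η₁ η₂ η₃ H x ≤ G e B₀ σ₁ σ₂ σ₃ η₁ η₂ η₃ H x' := by
  rw [G_eq_N3, G_eq_N3]
  refine N3_mono_left B₀ (fun y => mul_le_mul_of_nonneg_left (happ_le_happ e hH le_rfl hxx') ?_) (fun y => ?_) (fun y => ?_) <;>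
    split_ifs <;> norm_num

/-- Swapping copies 2 and 3 in `G`. [this work] -/
theorem G_swap23 (e : ℕ) (B₀ : Fin e → ℕ) (σ₁ σ₂ σ₃ : Pt e → Bool) (η₁ η₂ η₃ : Bool) (H : Pt (d + e) → ℝ) (x : Pt d) :
    G e B₀ σ₁ σ₃ σ₂ η₁ η₃ η₂ H x = G e B₀ σ₁ σ₂ σ₃ η₁ η₂ η₃ H x := by
  rw [G_eq_N3, G_eq_N3, N3_comm23]

/-! ### §2 Integrating out the block against a free function -/

/-- Linearity helper (first slot, function-level `if`). [this work] -/
theorem N3_mul_ite_left (b : Fin d → ℕ) (u F v w : Pt d → ℝ) (c : Prop) [Decidable c] :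
    N3 b (u * (if c then F else 0)) v w = if c then N3 b (u * F) v w else 0 := by
  split_ifs
  · rfl
  · rw [mul_zero, N3_zero_left]

/-- ★ **Integrating out the block**: for substituted `u, v, w` and a FREE factor `H` in the first copy,
`N_{(B₀,b)}((subst σ₁ u)·H; subst σ₂ v; subst σ₃ w) = Σ_{η ∈ Bool³} N_b(u^{η₁}·G(η)H; v^{η₂}; w^{η₃})`. [this work] -/
theorem N3_subst_mul : ∀ (e : ℕ) (B₀ : Fin e → ℕ) (b : Fin d → ℕ) (σ₁ σ₂ σ₃ : Pt e → Bool) (u v w : Pt (d + 1) → ℝ)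
    (H : Pt (d + e) → ℝ),
    N3 (appendProf e B₀ b) (subst e σ₁ u * H) (subst e σ₂ v) (subst e σ₃ w) =
      ∑ η₁ : Bool, ∑ η₂ : Bool, ∑ η₃ : Bool,
        N3 b (sec u η₁ * G e B₀ σ₁ σ₂ σ₃ η₁ η₂ η₃ H) (sec v η₂) (sec w η₃)
  | 0, B₀, b, σ₁, σ₂, σ₃, u, v, w, H => by
    -- one pattern only: `η = (σ₁ ∅, σ₂ ∅, σ₃ ∅)`
    simp only [appendProf, subst, G, Fintype.sum_bool]
    cases σ₁ (fun i => Fin.elim0 i) <;> cases σ₂ (fun i => Fin.elim0 i) <;> cases σ₃ (fun i => Fin.elim0 i) <;>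
      simp [N3_zero_left]
  | e + 1, B₀, b, σ₁, σ₂, σ₃, u, v, w, H => by
    have IH := fun ε₁ ε₂ ε₃ => N3_subst_mul e (Fin.tail B₀) b (fun y => σ₁ (Fin.cons ε₁ y)) (fun y => σ₂ (Fin.cons ε₂ y))
      (fun y => σ₃ (Fin.cons ε₃ y)) u v w (sec H ε₁)
    simp only [appendProf]
    rw [N3_cons]
    simp only [sec_mul, sec_subst, IH]
    -- unfold one layer of `G` on the right and distribute `N3` over the pattern sum
    match hk : B₀ 0 with
    | 0 =>
      simp [G, hk]
    | 1 =>
      simp [G, hk, N3_mul_add_left]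
      ring
    | 2 =>
      simp [G, hk, N3_mul_add_left]
      ring
    | 3 =>
      simp [G, hk]
    | k + 4 =>
      simp [G, hk, N3_zero_left]

/-! ### §3 The monotone third functions `h̃_k` -/

/-- The symmetrised pattern marginal: `H` read in copy 1 with `σ`-value `η`, the other two copies showing `s` ones
(`s = 0 ↦ (f,f)`, `1 ↦ (t,f)`, `2 ↦ (t,t)`; other `s ↦ 0`). [this work] -/
def Gs (e : ℕ) (B₀ : Fin e → ℕ) (σ : Pt e → Bool) (η : Bool) (s : ℕ) (H : Pt (d + e) → ℝ) : Pt d → ℝ :=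
  match s with
  | 0 => G e B₀ σ σ σ η false false H
  | 1 => G e B₀ σ σ σ η true false H
  | 2 => G e B₀ σ σ σ η true true H
  | _ + 3 => 0

/-- Every pattern marginal is a symmetrised one. [this work] -/
theorem G_eq_Gs (e : ℕ) (B₀ : Fin e → ℕ) (σ : Pt e → Bool) (η₁ η₂ η₃ : Bool) (H : Pt (d + e) → ℝ) :
    G e B₀ σ σ σ η₁ η₂ η₃ H = Gs e B₀ σ η₁ (η₂.toNat + η₃.toNat) H := by
  funext x
  cases η₂ <;> cases η₃ <;> simp only [Gs, Bool.toNat_true, Bool.toNat_false]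
  exact G_swap23 e B₀ σ σ σ η₁ true false H x

/-- The third functions `h̃_k` on `{0,1}^{d+1}` (`k = 0,…,3`): `h̃_k(η,x) = Gs(η, k − η)` on the sections that the profile entry `k`
reads, completed monotonically on the unread section (`h̃_0(1,·) := h̃_0(0,·)`, `h̃_3(0,·) := 0`). [this work] -/
def hk (e : ℕ) (B₀ : Fin e → ℕ) (σ : Pt e → Bool) (k : ℕ) (H : Pt (d + e) → ℝ) : Pt (d + 1) → ℝ := fun w =>
  match k, w 0 with
  | 0, _ => Gs e B₀ σ false 0 H (Fin.tail w)
  | 1, false => Gs e B₀ σ false 1 H (Fin.tail w)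
  | 1, true => Gs e B₀ σ true 0 H (Fin.tail w)
  | 2, false => Gs e B₀ σ false 2 H (Fin.tail w)
  | 2, true => Gs e B₀ σ true 1 H (Fin.tail w)
  | 3, false => 0
  | 3, true => Gs e B₀ σ true 2 H (Fin.tail w)
  | _ + 4, _ => 0

/-- Sections of `h̃_k`. [this work] -/
theorem sec_hk_zero (e : ℕ) (B₀ : Fin e → ℕ) (σ : Pt e → Bool) (H : Pt (d + e) → ℝ) (ε : Bool) :
    sec (hk e B₀ σ 0 H) ε = Gs e B₀ σ false 0 H := by funext x; cases ε <;> rfl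
/-- Sections of `h̃_k`. [this work] -/
theorem sec_hk_one_false (e : ℕ) (B₀ : Fin e → ℕ) (σ : Pt e → Bool) (H : Pt (d + e) → ℝ) :
    sec (hk e B₀ σ 1 H) false = Gs e B₀ σ false 1 H := rfl
/-- Sections of `h̃_k`. [this work] -/
theorem sec_hk_one_true (e : ℕ) (B₀ : Fin e → ℕ) (σ : Pt e → Bool) (H : Pt (d + e) → ℝ) :
    sec (hk e B₀ σ 1 H) true = Gs e B₀ σ true 0 H := rfl
/-- Sections of `h̃_k`. [this work] -/
theorem sec_hk_two_false (e : ℕ) (B₀ : Fin e → ℕ) (σ : Pt e → Bool) (H : Pt (d + e) → ℝ) :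
    sec (hk e B₀ σ 2 H) false = Gs e B₀ σ false 2 H := rfl
/-- Sections of `h̃_k`. [this work] -/
theorem sec_hk_two_true (e : ℕ) (B₀ : Fin e → ℕ) (σ : Pt e → Bool) (H : Pt (d + e) → ℝ) :
    sec (hk e B₀ σ 2 H) true = Gs e B₀ σ true 1 H := rfl
/-- Sections of `h̃_k`. [this work] -/
theorem sec_hk_three_true (e : ℕ) (B₀ : Fin e → ℕ) (σ : Pt e → Bool) (H : Pt (d + e) → ℝ) :
    sec (hk e B₀ σ 3 H) true = Gs e B₀ σ true 2 H := rfl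
/-- Sections of `h̃_k`. [this work] -/
theorem sec_hk_three_false (e : ℕ) (B₀ : Fin e → ℕ) (σ : Pt e → Bool) (H : Pt (d + e) → ℝ) :
    sec (hk e B₀ σ 3 H) false = 0 := rfl

/-- `h̃_k ≥ 0`. [this work] -/
theorem hk_nonneg (e : ℕ) (B₀ : Fin e → ℕ) (σ : Pt e → Bool) (k : ℕ) {H : Pt (d + e) → ℝ} (hH : ∀ w, 0 ≤ H w) (w : Pt (d + 1)) :
    0 ≤ hk e B₀ σ k H w := by
  have hG := fun η₁ η₂ η₃ => G_nonneg e B₀ σ σ σ η₁ η₂ η₃ hH (Fin.tail w)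
  unfold hk
  rcases k with _ | _ | _ | _ | k <;> cases w 0 <;> simp only [Gs] <;> first | exact hG _ _ _ | exact le_rfl

/-- ★ **The Harris step**: on the block, `Σ_{arr} σ(y¹)·(spectators) · [H(y¹,x)·… ]` comparisons —
`Gs(false, s+1) ≤ Gs(true, s)` for `s = 0, 1`, i.e. moving the `σ`-one onto the copy that carries `H` increases the count
(three-copy Harris `N(Hσ;1;r) ≥ N(H;σ;r)` with a spectator). [this work] -/
theorem Gs_false_le_Gs_true (e : ℕ) (B₀ : Fin e → ℕ) {σ : Pt e → Bool} (hσ : Monotone σ) {H : Pt (d + e) → ℝ}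
    (hH : ∀ w, 0 ≤ H w) (hHm : Monotone H) (x : Pt d) (ρ : Bool) :
    G e B₀ σ σ σ false true ρ H x ≤ G e B₀ σ σ σ true false ρ H x := by
  rw [G_eq_N3, G_eq_N3]
  -- notation on the block
  set a : Pt e → ℝ := fun y => happ e H y x with ha
  set s : Pt e → ℝ := fun y => if σ y = true then (1 : ℝ) else 0 with hs
  set sb : Pt e → ℝ := fun y => if σ y = false then (1 : ℝ) else 0 with hsb
  set r : Pt e → ℝ := fun y => if σ y = ρ then (1 : ℝ) else 0 with hr
  have ha0 : ∀ y, 0 ≤ a y := fun y => happ_nonneg e hH y x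
  have ham : Monotone a := fun y y' hyy' => happ_le_happ e hHm hyy' le_rfl
  have hs0 : ∀ y, 0 ≤ s y := fun y => by simp only [hs]; split_ifs <;> norm_num
  have hsm : Monotone s := by
    intro y y' hyy'
    have hle : σ y = true → σ y' = true := Bool.le_iff_imp.1 (hσ hyy')
    simp only [hs]
    by_cases h1 : σ y = true
    · rw [if_pos h1, if_pos (hle h1)]
    · rw [if_neg h1]; split_ifs <;> norm_num
  have hr0 : ∀ y, 0 ≤ r y := fun y => by simp only [hr]; split_ifs <;> norm_num
  have hsb_eq : sb = 1 - s := by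
    funext y; simp only [hsb, hs, Pi.sub_apply, Pi.one_apply]; cases σ y <;> simp
  -- the two sides
  have lhs : N3 B₀ (fun y => (if σ y = false then (1 : ℝ) else 0) * happ e H y x) (fun y => if σ y = true then 1 else 0) r =
      N3 B₀ (a * sb) s r := by congr 1; funext y; simp only [Pi.mul_apply, hsb, ha]; ring
  have rhs : N3 B₀ (fun y => (if σ y = true then (1 : ℝ) else 0) * happ e H y x) (fun y => if σ y = false then 1 else 0) r =
      N3 B₀ (a * s) sb r := by congr 1; funext y; simp only [Pi.mul_apply, hs, ha]; ring
  rw [lhs, rhs, hsb_eq]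
  -- expand `1 - s` and use three-copy Harris with the spectator `r`
  have e1 : N3 B₀ (a * (1 - s)) s r = N3 B₀ a s r - N3 B₀ (a * s) s r := by
    rw [mul_sub, mul_one, N3_sub_left]
  have e2 : N3 B₀ (a * s) (1 - s) r = N3 B₀ (a * s) 1 r - N3 B₀ (a * s) s r := by
    rw [N3_sub_mid]
  rw [e1, e2]
  have harris := N3_le_N3_mul e B₀ a s r ha0 ham hs0 hsm hr0
  linarith

/-- `h̃_k` is monotone on `{0,1}^{d+1}` (in the back point by monotonicity of `H`; in the substituted coordinate by the Harris step). [this work] -/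
theorem hk_monotone (e : ℕ) (B₀ : Fin e → ℕ) {σ : Pt e → Bool} (hσ : Monotone σ) (k : ℕ) {H : Pt (d + e) → ℝ}
    (hH : ∀ w, 0 ≤ H w) (hHm : Monotone H) : Monotone (hk e B₀ σ k H) := by
  intro w w' hww'
  have ht : Fin.tail w ≤ Fin.tail w' := fun i => hww' i.succ
  have h0 : w 0 ≤ w' 0 := hww' 0
  have mx := fun η₁ η₂ η₃ => G_mono_x e B₀ σ σ σ η₁ η₂ η₃ hHm ht
  have step := fun ρ => Gs_false_le_Gs_true e B₀ hσ hH hHm (Fin.tail w') ρ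
  have nn := fun η₁ η₂ η₃ => G_nonneg e B₀ σ σ σ η₁ η₂ η₃ hH (Fin.tail w')
  unfold hk
  rcases k with _ | _ | _ | _ | k
  · exact mx _ _ _
  · cases h1 : w 0 <;> cases h2 : w' 0 <;> simp only [Gs]
    · exact mx _ _ _
    · exact (mx _ _ _).trans (step false)
    · rw [h1, h2] at h0; exact absurd h0 (by decide)
    · exact mx _ _ _
  · cases h1 : w 0 <;> cases h2 : w' 0 <;> simp only [Gs]
    · exact mx _ _ _
    · exact (mx _ _ _).trans ((step true).trans (G_swap23 e B₀ σ σ σ true true false H _).le)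
    · rw [h1, h2] at h0; exact absurd h0 (by decide)
    · exact mx _ _ _
  · cases h1 : w 0 <;> cases h2 : w' 0 <;> simp only [Gs]
    · exact le_rfl
    · exact nn _ _ _
    · rw [h1, h2] at h0; exact absurd h0 (by decide)
    · exact mx _ _ _
  · exact le_rfl

/-! ### §4 The identity and the closure theorem -/

/-- ★★ **`c_{(B₀,b)}(subst σ f, subst σ g, H) = Σ_{k=0}^{3} c_{(k,b)}(f, g, h̃_k)`** for an ARBITRARY third function `H`. [this work] -/
theorem tc_subst_free (e : ℕ) (B₀ : Fin e → ℕ) (b : Fin d → ℕ) (σ : Pt e → Bool) (f g : Pt (d + 1) → ℝ) (H : Pt (d + e) → ℝ) :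
    tc (appendProf e B₀ b) (subst e σ f) (subst e σ g) H =
      tc (Fin.cons 0 b : Fin (d + 1) → ℕ) f g (hk e B₀ σ 0 H) + tc (Fin.cons 1 b : Fin (d + 1) → ℕ) f g (hk e B₀ σ 1 H)
      + tc (Fin.cons 2 b : Fin (d + 1) → ℕ) f g (hk e B₀ σ 2 H) + tc (Fin.cons 3 b : Fin (d + 1) → ℕ) f g (hk e B₀ σ 3 H) := by
  -- normalise: in every `N3` the factor carrying the free function sits in the FIRST copy
  have L : ∀ u v w : Pt (d + 1) → ℝ, N3 (appendProf e B₀ b) (subst e σ u * H) (subst e σ v) (subst e σ w) =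
      ∑ η₁ : Bool, ∑ η₂ : Bool, ∑ η₃ : Bool,
        N3 b (sec u η₁ * Gs e B₀ σ η₁ (η₂.toNat + η₃.toNat) H) (sec v η₂) (sec w η₃) := by
    intro u v w; rw [N3_subst_mul]; simp only [G_eq_Gs]
  have LA : ∀ u : Pt (d + 1) → ℝ, N3 (appendProf e B₀ b) (subst e σ u * H) 1 1 =
      ∑ η₁ : Bool, ∑ η₂ : Bool, ∑ η₃ : Bool, N3 b (sec u η₁ * Gs e B₀ σ η₁ (η₂.toNat + η₃.toNat) H) 1 1 := by
    intro u; have := L u 1 1; simp only [subst_one, sec_one] at this; exact this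
  have LB : ∀ u v : Pt (d + 1) → ℝ, N3 (appendProf e B₀ b) (subst e σ u * H) (subst e σ v) 1 =
      ∑ η₁ : Bool, ∑ η₂ : Bool, ∑ η₃ : Bool, N3 b (sec u η₁ * Gs e B₀ σ η₁ (η₂.toNat + η₃.toNat) H) (sec v η₂) 1 := by
    intro u v; have := L u v 1; simp only [subst_one, sec_one] at this; exact this
  have LC : ∀ v : Pt (d + 1) → ℝ, N3 (appendProf e B₀ b) H (subst e σ v) 1 =
      ∑ η₁ : Bool, ∑ η₂ : Bool, ∑ η₃ : Bool, N3 b (Gs e B₀ σ η₁ (η₂.toNat + η₃.toNat) H) (sec v η₂) 1 := by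
    intro v; have := L 1 v 1; simp only [subst_one, sec_one, one_mul] at this; exact this
  have LD : ∀ v w : Pt (d + 1) → ℝ, N3 (appendProf e B₀ b) H (subst e σ v) (subst e σ w) =
      ∑ η₁ : Bool, ∑ η₂ : Bool, ∑ η₃ : Bool, N3 b (Gs e B₀ σ η₁ (η₂.toNat + η₃.toNat) H) (sec v η₂) (sec w η₃) := by
    intro v w; have := L 1 v w; simp only [subst_one, sec_one, one_mul] at this; exact this
  unfold tc
  -- left-hand side: move `H` to the first copy and merge substituted products
  rw [N3_comm12 _ (subst e σ f) (subst e σ g * H) 1, N3_comm12 _ (subst e σ g) (subst e σ f * H) 1,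
    N3_comm13 _ (subst e σ f) (subst e σ g) H]
  rw [show subst e σ f * subst e σ g * H = subst e σ (f * g) * H by rw [subst_mul],
    show subst e σ f * subst e σ g = subst e σ (f * g) by rw [subst_mul]]
  rw [LA, LB, LB, LC, LD]
  -- right-hand side: the same normalisation, then the slice formulas
  rw [N3_comm12 _ f (g * hk e B₀ σ 0 H) 1, N3_comm12 _ g (f * hk e B₀ σ 0 H) 1, N3_comm13 _ f g (hk e B₀ σ 0 H),
    N3_comm12 _ f (g * hk e B₀ σ 1 H) 1, N3_comm12 _ g (f * hk e B₀ σ 1 H) 1, N3_comm13 _ f g (hk e B₀ σ 1 H),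
    N3_comm12 _ f (g * hk e B₀ σ 2 H) 1, N3_comm12 _ g (f * hk e B₀ σ 2 H) 1, N3_comm13 _ f g (hk e B₀ σ 2 H),
    N3_comm12 _ f (g * hk e B₀ σ 3 H) 1, N3_comm12 _ g (f * hk e B₀ σ 3 H) 1, N3_comm13 _ f g (hk e B₀ σ 3 H)]
  simp only [N3_cons_zero, N3_cons_one, N3_cons_two, N3_cons_three, sec_mul, sec_one, sec_hk_zero, sec_hk_one_false,
    sec_hk_one_true, sec_hk_two_false, sec_hk_two_true, sec_hk_three_true, Fintype.sum_bool,
    Bool.toNat_true, Bool.toNat_false, Nat.reduceAdd]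
  -- `Gs _ _ _ η 3 = 0`
  simp only [Gs]
  ring

/-- ★★ **Universally good pairs are closed under blockwise monotone substitution.**  If `(f,g)` on `{0,1}^{d+1}` satisfies
`c_{b'}(f,g,H') ≥ 0` for every profile `b'` and every nonnegative monotone `H'`, and `σ : {0,1}^e → Bool` is monotone, then
`c_B(subst σ f, subst σ g, H) ≥ 0` for every profile `B` of `{0,1}^{d+e}` and EVERY nonnegative monotone `H` on `{0,1}^{d+e}`. [this work] -/
theorem tc_subst_free_nonneg (e : ℕ) {σ : Pt e → Bool} (hσ : Monotone σ) {f g : Pt (d + 1) → ℝ}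
    (hfg : ∀ (b' : Fin (d + 1) → ℕ) (H' : Pt (d + 1) → ℝ), (∀ w, 0 ≤ H' w) → Monotone H' → 0 ≤ tc b' f g H')
    {H : Pt (d + e) → ℝ} (hH : ∀ w, 0 ≤ H w) (hHm : Monotone H) (B : Fin (d + e) → ℕ) :
    0 ≤ tc B (subst e σ f) (subst e σ g) H := by
  obtain ⟨B₀, b, rfl⟩ := exists_appendProf e B
  rw [tc_subst_free]
  have h0 := hfg (Fin.cons 0 b) (hk e B₀ σ 0 H) (hk_nonneg e B₀ σ 0 hH) (hk_monotone e B₀ hσ 0 hH hHm)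
  have h1 := hfg (Fin.cons 1 b) (hk e B₀ σ 1 H) (hk_nonneg e B₀ σ 1 hH) (hk_monotone e B₀ hσ 1 hH hHm)
  have h2 := hfg (Fin.cons 2 b) (hk e B₀ σ 2 H) (hk_nonneg e B₀ σ 2 hH) (hk_monotone e B₀ hσ 2 hH hHm)
  have h3 := hfg (Fin.cons 3 b) (hk e B₀ σ 3 H) (hk_nonneg e B₀ σ 3 hH) (hk_monotone e B₀ hσ 3 hH hHm)
  linarith

end

end Summit.CriticalPhenomena.PercolationContinuityZ3.Theorems.SahiThreeCopy
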